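import Literature.NumberTheory.EllipticCurves.ZpExtensionRelativeKernelFiniteProofs
import Literature.NumberTheory.EllipticCurves.TwoVariableSelmerTorsionFiniteProofs
import Literature.NumberTheory.EllipticCurves.TwoVariableAnticyclotomicControl
import HarnessLib

/-!
# Control from the `ℤ_p²`-tower to a `ℤ_p`-line, LOCAL part: the inertia conditions as restrictions, their
# conjugation invariance, and the finiteness of the `p`-torsion of `ker (H¹(J, E[p^∞]) → H¹(J', E[p^∞]))`
# along a procyclic step `J' ≤ J`

PROOFS-ONLY (no definition, no named fact, no `sorry`, no instance). Cell `bsd-2adic`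
(`run/shared/lean/pub/bsd-2adic/`), seat `bsd-2adic-tower-1` GEN 47, key «CTRL₂» of the O2 line
`Cruxes/BDPSelmerLowerDivisibilityAtTwo/Lines/two_variable_gv_squeeze_two.lean` (stub R0T, input (b): control
of `X_Gr(E/K̃_∞)/T₁` by one `ℤ_p`-line).

The control theorem compares Greenberg's Selmer group `datumSelmer G E[p^∞] p (bdpData v̄) ∅` over the line
`K_∞^{(2)} = K̄^{G}`, `G = ker κ₂`, with the preimage under restriction of the two-variable group
`unrSelmer₂ = datumSelmer N …`, `N = pairKer κ₁ κ₂`, over `K̃_∞`. Both impose, at every place (all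
`Γ_K`-conjugates of the chosen one), the vanishing of the restriction to an INERTIA group: `H ⊓ I_v` at
`v ∤ p` (unramified) and, for Castella's strict datum `M⁺_v̄ = 0` above `v̄`, again `H ⊓ I_v̄`
(Greenberg's condition `res ↦ 0 ∈ H¹(H ⊓ I_v̄, M/0)`). This file supplies:

* §1 the two conditions as plain restrictions: `c ∈ unramifiedKer H M v ↔ res_{H ⊓ I_v} c = 0`,
  `c ∈ (strictDatum M v).greenbergKer H ↔ res_{H ⊓ I_v} c = 0` (cocycle criteria; `M ⧸ 0 ≅ M`);
* §2 LEVEL CHANGE `H' ≤ H` when `H ⊓ I ≤ H'` (the two inertia groups coincide — the case `v ∤ p`, where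
  `I_v ≤ pairKer`): `res_{H' ⊓ I}(res c) = 0 ↔ res_{H ⊓ I} c = 0`; and CONJUGATION INVARIANCE: for `d` in the
  decomposition group `D_v` (which normalises `I_v`, `conj_mem_inertia_of_mem_decomp`) and `H` normal,
  `res_{H ⊓ I_v}(conj_d c) = 0 ↔ res_{H ⊓ I_v} c = 0` — so the condition at the place `dσg` (`g ∈ H`) is the
  condition at the place `σ`;
* §3 **`WeierstrassCurve.finite_setOf_resOfLe_eq_zero_and_nsmul_eq_zero`**: for subgroups `J' ≤ J ≤ Γ_K` with
  `J` closed and `J ⊓ ker κ ≤ J'` (a procyclic step, e.g. `J = ker κ₂ ⊓ I_v̄ ⊵ J' = pairKer ⊓ I_v̄`, or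
  `J = ker κ₂ ⊵ pairKer`) the classes `x ∈ H¹(J, E[p^∞])` with `res_{J'} x = 0` and `p x = 0` are FINITE: Kummer
  lift `x = ι_J ξ`, `ξ ∈ H¹(J, E[p])` (`exists_torsionToPrimaryH1Sub_eq`), `res_{J'} ξ ∈ ker ι_{J'}` finite
  (`finite_ker_torsionToPrimaryH1Sub`), fibres = translates of `ker (res : H¹(J, E[p]) → H¹(J', E[p]))`, finite
  by `ZpDescent.finite_setOf_resOfLe_eq_zero_of_inf_ker_le` (sibling file). This is Greenberg's Lemma 3.3/3.4
  mechanism ("`ker r_v ⊆ H¹` of a procyclic group with values in a cofinitely generated module") in the weak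
  currency "finite `p`-torsion", with no hypothesis on the reduction type.

## References
* [GreenbergLNM1716] R. Greenberg, LNM 1716 (1999), §3 Lemmas 3.1–3.4 (pp. 86–89).
* [SkinnerUrban2014] C. Skinner, E. Urban, Invent. Math. 195 (2014), §3.2.7 and Prop. 3.2.8 (p. 23).
* [SerreGaloisCohomology1997] J.-P. Serre, *Galois Cohomology*, I.§2.5–§2.6.
* [Greenberg1989] R. Greenberg, Adv. Stud. Pure Math. 17 (1989), §1 p. 98 (strict vs inertia condition).
-/

noncomputable section

open scoped Classical

open NumberField IsDedekindDomain Field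
open Literature.NumberTheory.GaloisRepresentations

universe u

namespace Literature.NumberTheory.EllipticCurves

/-! ## §1 The inertia conditions as restrictions -/

section Criteria

open GreenbergSelmer GreenbergVatsal2000 Castella2018

variable {K : Type u} [Field K] [NumberField K]
  {M : Type u} [AddCommGroup M] [DistribMulAction (absoluteGaloisGroup K) M] [TopologicalSpace M]
  [DiscreteTopology M]

/-- **The unramified condition is the vanishing of the restriction to `H ⊓ I_v`**: for any `H ≤ Γ_K`, any place
`v` and `c ∈ H¹(H, M)`, `c ∈ unramifiedKer H M v` (the kernel of `H¹(H, M) → H¹(H ⊓ I_v, M)` in GV's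
formalism, through the subgroup `inertiaIn H v` of `D_v`) iff `resOfLe M (H ⊓ I_v ≤ H) c = 0` (the same
restriction through the subgroup `H ⊓ I_v` of `Γ_K`). Both say: a representing cocycle is a coboundary on the
elements of `H ⊓ I_v`. [cite: GreenbergVatsal2000, §2 p. 17] [cite: SerreGaloisCohomology1997, I §2.5] -/
theorem mem_unramifiedKer_iff_resOfLe_eq_zero (H : Subgroup (absoluteGaloisGroup K))
    (v : HeightOneSpectrum (𝓞 K)) (c : subgroupH1 H M) :
    c ∈ GreenbergVatsal2000.unramifiedKer H M v ↔ resOfLe M (inf_le_left : H ⊓ inertia v ≤ H) c = 0 := by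
  obtain ⟨z, rfl⟩ := oneCocycleClass_surjective _ c
  rw [GreenbergVatsal2000.unramifiedKer, AddMonoidHom.mem_ker, CocycleCriteria.resH1Hom_oneCocycleClass_eq_zero_iff,
    CocycleCriteria.resOfLe_oneCocycleClass_eq_zero_iff]
  constructor
  · rintro ⟨a, ha⟩
    refine ⟨a, fun x ↦ ?_⟩
    have hx := Subgroup.mem_inf.mp x.2
    set x' : inertiaIn H v := ⟨⟨(x : absoluteGaloisGroup K), inertia_le_decomp v hx.2⟩,
      (mem_inertiaIn_iff H v _).2 hx⟩ with hx'
    have := ha x'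
    rw [AddMonoidHom.id_apply] at this
    exact this
  · rintro ⟨a, ha⟩
    refine ⟨a, fun x' ↦ ?_⟩
    have hx' := (mem_inertiaIn_iff H v _).1 x'.2
    have := ha ⟨((x' : decomp v) : absoluteGaloisGroup K), Subgroup.mem_inf.mpr hx'⟩
    rw [AddMonoidHom.id_apply]
    exact this

/-- **Greenberg's condition for Castella's STRICT datum `M⁺_v = 0` is the vanishing of the restriction to
`H ⊓ I_v`**: `c ∈ (strictDatum M v).greenbergKer H ↔ resOfLe M (H ⊓ I_v ≤ H) c = 0`. (The datum's graded
piece is `M ⧸ 0`, onto which `M` maps isomorphically: `LocalDatum.ker_grMk`.) Castella's "`0` if `w ∣ 𝔭`" read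
à la Greenberg (inertia in place of decomposition). [cite: Castella2018, Def. 2.2 (arXiv:1704.06608 p. 5)]
[cite: Greenberg1989, §1 p. 98 (4)] -/
theorem mem_greenbergKer_strictDatum_iff_resOfLe_eq_zero (H : Subgroup (absoluteGaloisGroup K))
    (v : HeightOneSpectrum (𝓞 K)) (c : subgroupH1 H M) :
    c ∈ (AcSelmer.strictDatum M v).greenbergKer H ↔
      resOfLe M (inf_le_left : H ⊓ inertia v ≤ H) c = 0 := by
  obtain ⟨z, rfl⟩ := oneCocycleClass_surjective _ c
  set D := AcSelmer.strictDatum M v with hD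
  have hinj : Function.Injective D.grMk := by
    rw [← AddMonoidHom.ker_eq_bot_iff, LocalDatum.ker_grMk]
    rfl
  rw [LocalDatum.mem_greenbergKer_iff, LocalDatum.greenbergMap,
    CocycleCriteria.resH1Hom_oneCocycleClass_eq_zero_iff, CocycleCriteria.resOfLe_oneCocycleClass_eq_zero_iff]
  constructor
  · rintro ⟨n, hn⟩
    obtain ⟨a, rfl⟩ := D.grMk_surjective n
    refine ⟨a, fun x ↦ ?_⟩
    have hx := Subgroup.mem_inf.mp x.2
    set x' : inertiaIn H v := ⟨⟨(x : absoluteGaloisGroup K), inertia_le_decomp v hx.2⟩,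
      (mem_inertiaIn_iff H v _).2 hx⟩ with hx'
    have h := hn x'
    rw [Subgroup.smul_def, LocalDatum.smul_grMk, ← map_sub] at h
    exact hinj h
  · rintro ⟨a, ha⟩
    refine ⟨D.grMk a, fun x' ↦ ?_⟩
    have hx' := (mem_inertiaIn_iff H v _).1 x'.2
    have h := ha ⟨((x' : decomp v) : absoluteGaloisGroup K), Subgroup.mem_inf.mpr hx'⟩
    rw [Subgroup.smul_def, LocalDatum.smul_grMk, ← map_sub]
    exact congrArg D.grMk h

/-! ## §2 Level change and conjugation invariance of the inertia condition -/

omit [NumberField K] in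
/-- **Level change.** For subgroups `H' ≤ H ≤ Γ_K` and a subgroup `I` with `H ⊓ I ≤ H'` (so that
`H ⊓ I = H' ⊓ I`: the two levels have THE SAME local group), a class `c ∈ H¹(H, M)` dies on `H ⊓ I` iff its
restriction to `H'` dies on `H' ⊓ I`. Use: `I = I_v`, `v ∤ p`, `H = Gal(K̄/K_∞^{(2)}) ≥ H' = Gal(K̄/K̃_∞) ≥ I_v`
(`ℤ_p`-extensions are unramified outside `p`) — away from `p` the unramified conditions over the line and over
the tower coincide, which is why only the places above `p` enter the control theorem
(Greenberg: "`F_∞/F` is unramified at `v` … the inertia subgroup is the same").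
[cite: GreenbergLNM1716, §3 proof of Lemma 3.3 (p. 88)] [cite: SerreGaloisCohomology1997, I §2.5] -/
theorem resOfLe_inf_resOfLe_eq_zero_iff {H H' : Subgroup (absoluteGaloisGroup K)} (hle : H' ≤ H)
    (I : Subgroup (absoluteGaloisGroup K)) (hI : H ⊓ I ≤ H') (c : subgroupH1 H M) :
    resOfLe M (inf_le_left : H' ⊓ I ≤ H') (resOfLe M hle c) = 0 ↔
      resOfLe M (inf_le_left : H ⊓ I ≤ H) c = 0 := by
  obtain ⟨z, rfl⟩ := oneCocycleClass_surjective _ c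
  have hcomp : resOfLe M (inf_le_left : H' ⊓ I ≤ H') (resOfLe M hle (oneCocycleClass _ z)) =
      resOfLe M ((inf_le_left : H' ⊓ I ≤ H').trans hle) (oneCocycleClass _ z) := by
    rw [← AddMonoidHom.comp_apply, resOfLe_comp_holds]
  rw [hcomp, CocycleCriteria.resOfLe_oneCocycleClass_eq_zero_iff,
    CocycleCriteria.resOfLe_oneCocycleClass_eq_zero_iff]
  constructor
  · rintro ⟨a, ha⟩
    refine ⟨a, fun x ↦ ?_⟩
    have hx := Subgroup.mem_inf.mp x.2
    have hx' : (x : absoluteGaloisGroup K) ∈ H' ⊓ I := Subgroup.mem_inf.mpr ⟨hI x.2, hx.2⟩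
    exact ha ⟨x, hx'⟩
  · rintro ⟨a, ha⟩
    refine ⟨a, fun x ↦ ?_⟩
    have hx := Subgroup.mem_inf.mp x.2
    have hx' : (x : absoluteGaloisGroup K) ∈ H ⊓ I := Subgroup.mem_inf.mpr ⟨hle hx.1, hx.2⟩
    exact ha ⟨x, hx'⟩

omit [NumberField K] in
/-- **Level change, one direction, no hypothesis**: if `c ∈ H¹(H, M)` dies on `H ⊓ I` then its restriction
to `H' ≤ H` dies on `H' ⊓ I` (restriction in stages). [cite: SerreGaloisCohomology1997, I §2.5] -/
theorem resOfLe_inf_resOfLe_eq_zero_of {H H' : Subgroup (absoluteGaloisGroup K)} (hle : H' ≤ H)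
    (I : Subgroup (absoluteGaloisGroup K)) {c : subgroupH1 H M}
    (hc : resOfLe M (inf_le_left : H ⊓ I ≤ H) c = 0) :
    resOfLe M (inf_le_left : H' ⊓ I ≤ H') (resOfLe M hle c) = 0 := by
  have h1 : resOfLe M (inf_le_left : H' ⊓ I ≤ H') (resOfLe M hle c) =
      resOfLe M ((inf_le_left : H' ⊓ I ≤ H').trans hle) c := by
    rw [← AddMonoidHom.comp_apply, resOfLe_comp_holds]
  have h2 : resOfLe M ((inf_le_left : H' ⊓ I ≤ H').trans hle) c =
      resOfLe M (inf_le_inf_right I hle : H' ⊓ I ≤ H ⊓ I) (resOfLe M (inf_le_left : H ⊓ I ≤ H) c) := by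
    rw [← AddMonoidHom.comp_apply, resOfLe_comp_holds]
  rw [h1, h2, hc, map_zero]

/-- **Generators of the image of a CLOSED subgroup are reached exactly**: if `D ≤ Γ_K` is closed and `q ∈ D`,
every `ℤ_p`-multiple of `κ q` is a value `κ d`, `d ∈ D` (`κ(D)` is compact, hence closed, and contains the
dense subset `ℕ · κ(q)` of `ℤ_p · κ(q)`, `PadicInt.denseRange_natCast`). With §2 of the sibling file
(`exists_mem_forall_exists_toAdd_eq_mul`): `κ(D) = ℤ_p · κ(q)` exactly — the closed subgroups of `ℤ_p` are the
`p^k ℤ_p` and `0`. [cite: Washington1997, §13.1] -/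
theorem exists_mem_toAdd_eq_mul_of_isClosed {p : ℕ} [Fact p.Prime] (κ : ZpExtension K p)
    {D : Subgroup (absoluteGaloisGroup K)} (hD : IsClosed (D : Set (absoluteGaloisGroup K)))
    {q : absoluteGaloisGroup K} (hq : q ∈ D) (a : ℤ_[p]) :
    ∃ d ∈ D, (κ d).toAdd = a * (κ q).toAdd := by
  haveI : CompactSpace D := isCompact_iff_compactSpace.mp hD.isCompact
  set x : ℤ_[p] := (κ q).toAdd with hxdef
  let f : D → ℤ_[p] := fun h ↦ (κ (h : absoluteGaloisGroup K)).toAdd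
  have hf : Continuous f :=
    continuous_toAdd.comp ((map_continuous κ).comp continuous_subtype_val)
  have hS : IsClosed (Set.range f) := (isCompact_range hf).isClosed
  have hZ : (fun a : ℤ_[p] ↦ a * x) '' Set.range (Nat.cast : ℕ → ℤ_[p]) ⊆ Set.range f := by
    rintro _ ⟨_, ⟨n, rfl⟩, rfl⟩
    refine ⟨(⟨q, hq⟩ : D) ^ n, ?_⟩
    change (κ (((⟨q, hq⟩ : D) ^ n : D) : absoluteGaloisGroup K)).toAdd = (n : ℤ_[p]) * x
    rw [SubgroupClass.coe_pow, map_pow, toAdd_pow, nsmul_eq_mul]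
  have hmul : Continuous fun a : ℤ_[p] ↦ a * x := continuous_id.mul continuous_const
  have h1 : a * x ∈ (fun a : ℤ_[p] ↦ a * x) '' closure (Set.range (Nat.cast : ℕ → ℤ_[p])) := by
    rw [(PadicInt.denseRange_natCast (p := p)).closure_eq]
    exact ⟨a, Set.mem_univ _, rfl⟩
  have h2 := image_closure_subset_closure_image hmul h1
  have h3 : a * x ∈ Set.range f := by
    rw [← hS.closure_eq]
    exact closure_mono hZ h2
  obtain ⟨d, hd⟩ := h3
  exact ⟨d, d.2, hd⟩

/-- **The decomposition group normalises the inertia group**: for `d ∈ D_v` and `i ∈ I_v` (the groups of the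
chosen prime above `v`), `d⁻¹ i d ∈ I_v` — `I_v = res(I_{K_v})`, `D_v = res(Γ_{K_v})` and `I_{K_v} ⊴ Γ_{K_v}`
(`absInertia_normal_holds`). [cite: SerreLocalFields1979, I §7 Prop. 20] -/
theorem conj_mem_inertia_of_mem_decomp (v : HeightOneSpectrum (𝓞 K)) {d i : absoluteGaloisGroup K}
    (hd : d ∈ decomp v) (hi : i ∈ inertia v) : d⁻¹ * i * d ∈ inertia v := by
  obtain ⟨δ, rfl⟩ := (mem_decomp_iff v d).1 hd
  obtain ⟨ι, hι, rfl⟩ := Subgroup.mem_map.mp hi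
  haveI := absInertia_normal_holds (v.adicCompletion K)
  refine Subgroup.mem_map.mpr ⟨δ⁻¹ * ι * δ, ?_, by simp only [map_mul, map_inv]; rfl⟩
  simpa only [inv_inv] using (inferInstance : (absInertia (v.adicCompletion K)).Normal).conj_mem ι hι δ⁻¹

/-- Symmetric form: `d i d⁻¹ ∈ I_v`. [cite: SerreLocalFields1979, I §7 Prop. 20] -/
theorem conj_mem_inertia_of_mem_decomp' (v : HeightOneSpectrum (𝓞 K)) {d i : absoluteGaloisGroup K}
    (hd : d ∈ decomp v) (hi : i ∈ inertia v) : d * i * d⁻¹ ∈ inertia v := by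
  simpa only [inv_inv] using conj_mem_inertia_of_mem_decomp v ((decomp v).inv_mem hd) hi

/-- **Conjugation invariance of the inertia condition.** For `H ⊴ Γ_K`, a class `c ∈ H¹(H, M)` and `d` in the
decomposition group `D_v`: `conj_d c` dies on `H ⊓ I_v` iff `c` does — on cocycles, `x ↦ d • z(d⁻¹ x d)` is a
coboundary on `H ⊓ I_v` iff `z` is one on `d⁻¹ (H ⊓ I_v) d = H ⊓ I_v`. Together with `conj_g c = c` for
`g ∈ H` (`conjH1_of_mem`): the local condition at the place `d σ g` is the local condition at the place `σ`, so
the conditions at the places of `K̄^H` above `v` are indexed by the double cosets `D_v \ Γ_K / H`.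
[cite: SerreGaloisCohomology1997, I §2.5] [cite: GreenbergLNM1716, §3 (p. 85: the places `η` of `F_n` lying over `v`)] -/
theorem resOfLe_inf_inertia_conjH1_eq_zero_iff (H : Subgroup (absoluteGaloisGroup K)) [H.Normal]
    (v : HeightOneSpectrum (𝓞 K)) {d : absoluteGaloisGroup K} (hd : d ∈ decomp v) (c : subgroupH1 H M) :
    resOfLe M (inf_le_left : H ⊓ inertia v ≤ H) (conjH1 H M d c) = 0 ↔
      resOfLe M (inf_le_left : H ⊓ inertia v ≤ H) c = 0 := by
  obtain ⟨z, rfl⟩ := oneCocycleClass_surjective _ c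
  rw [CocycleCriteria.conjH1_oneCocycleClass_mem_ker_resOfLe_iff,
    CocycleCriteria.resOfLe_oneCocycleClass_eq_zero_iff]
  -- `d⁻¹ x d ∈ H ⊓ I_v` and `d x d⁻¹ ∈ H ⊓ I_v` for `x ∈ H ⊓ I_v`
  have hconj : ∀ x : absoluteGaloisGroup K, x ∈ H ⊓ inertia v → d⁻¹ * x * d ∈ H ⊓ inertia v := fun x hx ↦
    Subgroup.mem_inf.mpr ⟨by simpa only [inv_inv] using
      (inferInstance : H.Normal).conj_mem x (Subgroup.mem_inf.mp hx).1 d⁻¹,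
      conj_mem_inertia_of_mem_decomp v hd (Subgroup.mem_inf.mp hx).2⟩
  have hconj' : ∀ x : absoluteGaloisGroup K, x ∈ H ⊓ inertia v → d * x * d⁻¹ ∈ H ⊓ inertia v := fun x hx ↦
    Subgroup.mem_inf.mpr ⟨(inferInstance : H.Normal).conj_mem x (Subgroup.mem_inf.mp hx).1 d,
      conj_mem_inertia_of_mem_decomp' v hd (Subgroup.mem_inf.mp hx).2⟩
  -- the conjugated element, as a member of `H`
  have hval : ∀ x : ↥(H ⊓ inertia v),
      subgroupConj H d (Subgroup.inclusion (inf_le_left : H ⊓ inertia v ≤ H) x) =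
        Subgroup.inclusion (inf_le_left : H ⊓ inertia v ≤ H) ⟨d⁻¹ * x * d, hconj x x.2⟩ :=
    fun x ↦ Subtype.ext (by rw [subgroupConj_apply_coe]; rfl)
  constructor
  · rintro ⟨a, ha⟩
    refine ⟨d⁻¹ • a, fun y ↦ ?_⟩
    -- `x = d y d⁻¹`
    set x : ↥(H ⊓ inertia v) := ⟨d * y * d⁻¹, hconj' y y.2⟩ with hx
    have hyx : (⟨d⁻¹ * x * d, hconj x x.2⟩ : ↥(H ⊓ inertia v)) = y :=
      Subtype.ext (by change d⁻¹ * (d * y * d⁻¹) * d = y; group)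
    have h := ha x
    rw [hval x, hyx] at h
    -- `z y = d⁻¹ • (x • a - a)`
    have h' : z.1 (Subgroup.inclusion (inf_le_left : H ⊓ inertia v ≤ H) y) =
        d⁻¹ • (((x : absoluteGaloisGroup K)) • a - a) := by
      rw [← h, inv_smul_smul]
    rw [h', smul_sub, smul_smul, smul_smul]
    congr 1
    change (d⁻¹ * (d * y * d⁻¹)) • a = ((y : absoluteGaloisGroup K) * d⁻¹) • a
    congr 1
    group
  · rintro ⟨a, ha⟩
    refine ⟨d • a, fun x ↦ ?_⟩
    rw [hval x, ha ⟨d⁻¹ * x * d, hconj x x.2⟩, smul_sub, smul_smul, smul_smul]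
    congr 1
    change (d * (d⁻¹ * x * d)) • a = ((x : absoluteGaloisGroup K) * d) • a
    congr 1
    group

/-- `I_v ≤ Γ_K` is closed (it is the inertia group of the chosen prime of `\bar ℤ_K` above `v`,
`absIntegers.isClosed_inertia_holds`). [cite: NeukirchANT1999, Ch. II §9 (9.6)] -/
theorem isClosed_inertia (v : HeightOneSpectrum (𝓞 K)) :
    IsClosed ((inertia v : Subgroup (absoluteGaloisGroup K)) : Set (absoluteGaloisGroup K)) := by
  rw [GreenbergSelmer.inertia, ← inertia_adicCompletionPrime_eq_map_absInertia]
  exact absIntegers.isClosed_inertia_holds (R := 𝓞 K) (K := K) (adicCompletionPrime K v)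

omit [NumberField K] in
/-- `ker κ = Gal(K̄/K_∞) ≤ Γ_K` is closed (a `ℤ_p`-extension is cut out by a continuous character into the
Hausdorff group `ℤ_p`; Washington: "`K_∞/K` … Galois with group `ℤ_p`", closed subgroups of `Γ_K`).
[cite: Washington1997, §13.1] -/
theorem isClosed_kerSubgroup' {p : ℕ} [Fact p.Prime] (κ : ZpExtension K p) :
    IsClosed ((κ.kerSubgroup : Subgroup (absoluteGaloisGroup K)) : Set (absoluteGaloisGroup K)) := by
  have : ((κ.kerSubgroup : Subgroup (absoluteGaloisGroup K)) : Set (absoluteGaloisGroup K)) = κ ⁻¹' {1} := by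
    ext σ; simp
  rw [this]
  exact isClosed_singleton.preimage (map_continuous κ)

end Criteria

end Literature.NumberTheory.EllipticCurves

/-! ## §3 Finite `p`-torsion of the kernel of restriction along a procyclic step, coefficients `E[p^∞]` -/

namespace WeierstrassCurve

open scoped Classical
open NumberField IsDedekindDomain Field Literature.NumberTheory.EllipticCurves
  Literature.NumberTheory.GaloisRepresentations

variable {K : Type u} [Field K] [NumberField K] (W : WeierstrassCurve K) (p : ℕ) [Fact p.Prime]

omit [NumberField K] [Fact p.Prime] in
/-- Naturality of `(E[p] ↪ E[p^∞])_*` with restriction: `res ∘ ι = ι ∘ res` (universe-polymorphic restatement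
of the tree's `FineSelmerCoefficientMap.resOfLe_torsionToPrimaryH1Sub`). [cite: SerreGaloisCohomology1997, I §2.4] -/
theorem resOfLe_torsionToPrimaryH1Sub_apply {H₁ H₂ : Subgroup (absoluteGaloisGroup K)} (hle : H₁ ≤ H₂)
    (y : Literature.NumberTheory.EllipticCurves.subgroupH1 H₂ (geomTorsion W (p : ℤ))) :
    Literature.NumberTheory.EllipticCurves.resOfLe (geomPrimaryTorsion W p) hle (W.torsionToPrimaryH1Sub p H₂ y) =
      W.torsionToPrimaryH1Sub p H₁
        (Literature.NumberTheory.EllipticCurves.resOfLe (↥(geomTorsion W (p : ℤ))) hle y) := by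
  change ((Literature.NumberTheory.EllipticCurves.resOfLe (geomPrimaryTorsion W p) hle).comp
      (W.torsionToPrimaryH1Sub p H₂)) y =
    ((W.torsionToPrimaryH1Sub p H₁).comp
      (Literature.NumberTheory.EllipticCurves.resOfLe (↥(geomTorsion W (p : ℤ))) hle)) y
  rw [WeierstrassCurve.torsionToPrimaryH1Sub, WeierstrassCurve.torsionToPrimaryH1Sub,
    Literature.NumberTheory.EllipticCurves.resOfLe, Literature.NumberTheory.EllipticCurves.resOfLe,
    resH1Hom_comp, resH1Hom_comp]
  exact congrArg (fun f : Literature.NumberTheory.EllipticCurves.subgroupH1 H₂ (geomTorsion W (p : ℤ)) →+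
      W.subgroupH1 p H₁ ↦ f y)
    (resH1Hom_congr (ContinuousMonoidHom.ext fun _ ↦ rfl) (AddMonoidHom.ext fun _ ↦ rfl) _ _)

/-- **Finite `p`-torsion of the kernel of restriction along a procyclic step.** Let `κ` be a
`ℤ_p`-extension of the number field `K`, `J' ≤ J ≤ Γ_K` subgroups with `J` closed and `J ⊓ ker κ ≤ J'` (so
`J/J' ↪ κ(J) ≅ p^k ℤ_p` is procyclic), and `W/K` an elliptic curve. Then the classes `x ∈ H¹(J, E[p^∞])` with
`res_{J'} x = 0` and `p x = 0` form a FINITE set. Proof: `x = ι_J ξ` with `ξ ∈ H¹(J, E[p])` (Kummer,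
`exists_torsionToPrimaryH1Sub_eq`); `res_{J'} ξ` lies in the finite kernel of `ι_{J'}`
(`finite_ker_torsionToPrimaryH1Sub`); two `ξ` with the same `res_{J'} ξ` differ by an element of
`ker (H¹(J, E[p]) → H¹(J', E[p]))`, finite (`ZpDescent.finite_setOf_resOfLe_eq_zero_of_inf_ker_le`). Examples:
`J = Gal(K̄/K_∞^{(2)}) ⊓ I_v̄ ⊵ J' = Gal(K̄/K̃_∞) ⊓ I_v̄` (the local term above `v̄` of the control theorem) and
`J = Gal(K̄/K_∞^{(2)}) ⊵ Gal(K̄/K̃_∞)` (the inflation term) — Greenberg's Lemmas 3.1/3.3 mechanism in the currency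
"finite `p`-torsion" (= cofinitely generated), any reduction type, any prime.
[cite: GreenbergLNM1716, §3 Lemmas 3.1, 3.3 (pp. 86, 88)] [cite: SerreGaloisCohomology1997, I §2.6 (b)] -/
theorem finite_setOf_resOfLe_eq_zero_and_nsmul_eq_zero [W.IsElliptic] (κ : ZpExtension K p)
    {J J' : Subgroup (absoluteGaloisGroup K)} (hJ : IsClosed (J : Set (absoluteGaloisGroup K)))
    (hle : J' ≤ J) (hJ' : ∀ g ∈ J, κ g = 1 → g ∈ J') :
    Set.Finite {x : W.subgroupH1 p J |
      Literature.NumberTheory.EllipticCurves.resOfLe (geomPrimaryTorsion W p) hle x = 0 ∧ p • x = 0} := by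
  classical
  have hp := (Fact.out : p.Prime)
  let ιJ := W.torsionToPrimaryH1Sub p J
  let ιJ' := W.torsionToPrimaryH1Sub p J'
  let r := Literature.NumberTheory.EllipticCurves.resOfLe (↥(geomTorsion W (p : ℤ))) hle
  haveI : Finite (geomTorsion W (p : ℤ)) :=
    finite_torsionPoints_holds W (AlgebraicClosure K) (by exact_mod_cast hp.ne_zero)
  haveI : ContinuousSMul (absoluteGaloisGroup K) (geomTorsion W (p : ℤ)) :=
    continuousSMul_geomTorsion W (isOpen_stabilizer_point_holds W) _
  -- the finite kernel of `ι_{J'}` and the finite kernel of `res : H¹(J, E[p]) → H¹(J', E[p])`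
  have hF := W.finite_ker_torsionToPrimaryH1Sub p (H := J') W.zsmul_geomPoints_surjective_holds
  have hR := ZpDescent.finite_setOf_resOfLe_eq_zero_of_inf_ker_le κ (M := geomTorsion W (p : ℤ)) hJ hle hJ'
  -- `L = {ξ | res ξ ∈ ker ι_{J'}}` is finite: fibres over the finite kernel are translates of `ker res`
  have hL : Set.Finite {ξ : Literature.NumberTheory.EllipticCurves.subgroupH1 J (geomTorsion W (p : ℤ)) |
      r ξ ∈ ιJ'.ker} := by
    have hsub : {ξ : Literature.NumberTheory.EllipticCurves.subgroupH1 J (geomTorsion W (p : ℤ)) | r ξ ∈ ιJ'.ker} ⊆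
        ⋃ f ∈ (ιJ'.ker : Set _), {ξ | r ξ = f} := by
      intro ξ hξ
      simp only [Set.mem_iUnion, Set.mem_setOf_eq, SetLike.mem_coe, exists_prop]
      exact ⟨r ξ, hξ, rfl⟩
    refine (hF.biUnion fun f _ ↦ ?_).subset hsub
    by_cases hne : {ξ : Literature.NumberTheory.EllipticCurves.subgroupH1 J (geomTorsion W (p : ℤ)) | r ξ = f}.Nonempty
    · obtain ⟨ξ₀, hξ₀⟩ := hne
      refine (hR.image fun a ↦ ξ₀ + a).subset ?_
      intro ξ hξ
      refine ⟨ξ - ξ₀, ?_, by abel⟩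
      change r (ξ - ξ₀) = 0
      rw [map_sub, show r ξ = f from hξ, show r ξ₀ = f from hξ₀, sub_self]
    · rw [Set.not_nonempty_iff_eq_empty.mp hne]
      exact Set.finite_empty
  -- the target set lies in `ι_J '' L`
  refine (hL.image ιJ).subset ?_
  rintro x ⟨hx, hpx⟩
  obtain ⟨ξ, rfl⟩ := W.exists_torsionToPrimaryH1Sub_eq p (H := J) W.zsmul_geomPoints_surjective_holds hpx
  refine ⟨ξ, ?_, rfl⟩
  change ιJ' (r ξ) = 0
  rw [← resOfLe_torsionToPrimaryH1Sub_apply]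
  exact hx

end WeierstrassCurve

end
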